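import Summits.KontsevichZagierPeriods.KontsevichZagierPeriods.Theses.HermiteRigidity
import Summits.KontsevichZagierPeriods.KontsevichZagierPeriods.Theorems.HermiteRigidityReductionRigidityBoxTwoReduction
import Summits.KontsevichZagierPeriods.KontsevichZagierPeriods.Theorems.HermiteRigidityReductionRigidityLineRigidity

/-!
# KontsevichZagierPeriods / HermiteRigidity — `PadeBoxIslands` (stmt-KontsevichZagierPeriods-15909)

Route `KontsevichZagierPeriods/HermiteRigidity`, support item stmt-KontsevichZagierPeriods-15909
(`PadeBoxIslands`, rank 9): THE PADÉ BOX ISLANDS — Conjecture 1 IN KERNEL FORM on the box sectors of every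
integer level `N ≥ 2`:

* `padeBoxKernelOne N` — UNCONDITIONALLY on the line island generated by `[□¹, x^a/(N − x)^m]` and the
  rational constants `[pt, q]` (`□ = [0,1]`; the rigidity of `1, L₁ = ∫_□ dx/(N − x) = log (N/(N−1))` is
  Baker's theorem, proved in the tree and consumed through the landed `stub_lineRigidity`);
* `padeBoxKernelTwo N` — on the `(2, 1/N)` box island generated by `[□², x^a y^b/(N − xy)^m]`,
  `[□¹, x^a/(N − x)^m]`, `[pt, q]`, CONDITIONALLY on the inlined `ℚ`-rigidity of
  `1, L₁, L₂ = ∫_□² dxdy/(N − xy) = Li₂(1/N)` (a theorem of Padé type for `N ≥ 9`, Viola–Zudilin 2018 /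
  Hata 1990);
* `padeBoxIslands_proof` — the conjunction over all `N ≥ 2`, typed as the route declaration
  `Theses.HermiteRigidity.PadeBoxIslands` (the closed cube written `{x | ∀ i, 0 ≤ x i ∧ x i ≤ 1}` there is
  definitionally `KZ.cube n`).

Pure glue over the landed stubs of the lead's line `Sketch` (`stub_boxTwoReduction`, `lineReduction`,
`stub_lineRigidity`, the normal-form toolkit `exists_nf*`, `carrier_add`, `carrier_zero`,
`nf_families_additive` in `Theorems/HermiteRigidityReductionRigidity{LineReduction,BoxTwoReduction,LineRigidity}.lean`):
closure induction to a rational normal form `[α/(N−xy)] + [β/(N−x)] + [γ]`, soundness, rigidity ⇒ zero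
integrands ⇒ relation. No variable is ever integrated out (barrier `noSemialgebraicPrimitive_inv_sub_two`
not met).
-- adapted from Cruxes/ReductionRigidity/Split.lean @ e6221e733755 (`padeBoxKernelOne/Two`,
-- `padeBoxIslands_proof`; planner-cstrat-stmt-KontsevichZagierPeriods-3407-d1-0 over the lead
-- prover-line-stmt-KontsevichZagierPeriods-3407-c4-0's Lines/Sketch.lean, whose landing p110927 was lost to a gate restart)

References: M. Kontsevich, D. Zagier, *Periods* (2001), §1.2 [cite: KontsevichZagier2001, §1.2];
C. Viola, W. Zudilin, *Linear independence of dilogarithmic values* (2018), Thm 1 [cite: ViolaZudilin2018, Thm 1];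
A. Baker, *Transcendental Number Theory* (1975), Thm 2.1 [cite: Baker1975, Thm 2.1].
-/

noncomputable section

open MeasureTheory Set MvPolynomial

namespace Summit.KontsevichZagierPeriods.HermiteRigidity.PadeBoxIslands

open Literature.NumberTheory.Transcendental
open Literature.NumberTheory.Transcendental.KZ
open Summit.KontsevichZagierPeriods.HermiteRigidity.ReductionRigidity

/-! ## The values of the normal forms (soundness `relations ≤ ker eval` is the tree's
`relations_le_ker_eval_holds`, used inline below) -/

/-- Value of the box normal form: `eval [□², α/(N−xy)] = α · L₂`. [folklore] -/
theorem eval_nf2 {N : ℕ} {α : ℚ} {s : IntegralRep 2} (hs : s.domain = cube 2)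
    (hsi : EqOn s.integrand (fun p => (α : ℝ) / ((N : ℝ) - p 0 * p 1)) (cube 2)) :
    KZ.eval (KZ.of s) = (α : ℝ) * ∫ p in cube 2, 1 / ((N : ℝ) - p 0 * p 1) := by
  rw [eval_of, IntegralRep.value, hs, setIntegral_congr_fun measurableSet_cube hsi, ← integral_const_mul]
  refine setIntegral_congr_fun measurableSet_cube fun p _ => ?_
  rw [div_eq_mul_one_div]

/-- Value of the line normal form: `eval [□¹, β/(N−x)] = β · L₁`. [folklore] -/
theorem eval_nf1 {N : ℕ} {β : ℚ} {s : IntegralRep 1} (hs : s.domain = cube 1)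
    (hsi : EqOn s.integrand (fun p => (β : ℝ) / ((N : ℝ) - p 0)) (cube 1)) :
    KZ.eval (KZ.of s) = (β : ℝ) * ∫ p in cube 1, 1 / ((N : ℝ) - p 0) := by
  rw [eval_of, IntegralRep.value, hs, setIntegral_congr_fun measurableSet_cube hsi, ← integral_const_mul]
  refine setIntegral_congr_fun measurableSet_cube fun p _ => ?_
  rw [div_eq_mul_one_div]

/-- Value of a rational constant in dimension `0`: `eval [pt, γ] = γ` (the one-point space has
volume `1`). [folklore] -/
theorem eval_nf0 {γ : ℚ} {s : IntegralRep 0} (hs : s.domain = cube 0)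
    (hsi : EqOn s.integrand (fun _ => (γ : ℝ)) (cube 0)) : KZ.eval (KZ.of s) = (γ : ℝ) := by
  rw [eval_of, IntegralRep.value, hs, setIntegral_congr_fun measurableSet_cube hsi]
  have hcube : cube 0 = (univ : Set (Fin 0 → ℝ)) := eq_univ_of_forall fun x i => i.elim0
  rw [hcube, setIntegral_univ, Measure.volume_pi_eq_dirac (default : Fin 0 → ℝ), integral_dirac]

/-- **The weight-two island** `padeBoxKernelTwo N` (glue over the landed `stub_boxTwoReduction`,
`lineReduction`, soundness and the inlined rigidity): Conjecture 1 in kernel form on the `(2, 1/N)` box sector —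
every `ℤ`-combination of the generators `[□², x^a y^b/(N−xy)^m]`, `[□¹, x^c/(N−x)^m]`, `[pt, q]`
of value `0` lies in `KZ.relations`, PROVIDED `1, L₁ = ∫_□ dx/(N−x), L₂ = ∫_□² dxdy/(N−xy)` are
linearly independent over `ℚ`. Proof: the set of classes congruent to a normal form
`[α/(N−xy)] + [β/(N−x)] + [γ]` (`α, β, γ ∈ ℚ`) is a subgroup containing the generators (the two
reductions), so it contains the closure; a normal form of value `αL₂ + βL₁ + γ = 0` has
`α = β = γ = 0` by rigidity, hence zero integrands, hence is a relation.
[cite: KontsevichZagier2001, §1.2] [cite: ViolaZudilin2018, Thm 1] -/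
theorem padeBoxKernelTwo (N : ℕ) (hN : 2 ≤ N)
    (hrig : ∀ a b c : ℚ, (a : ℝ) + b * (∫ p in cube 1, 1 / ((N : ℝ) - p 0)) +
        c * (∫ p in cube 2, 1 / ((N : ℝ) - p 0 * p 1)) = 0 → a = 0 ∧ b = 0 ∧ c = 0) :
    ∀ c ∈ AddSubgroup.closure
      ({c | ∃ (r : IntegralRep 2) (a b m : ℕ), r.domain = cube 2 ∧
          EqOn r.integrand (fun p => p 0 ^ a * p 1 ^ b / ((N : ℝ) - p 0 * p 1) ^ m) (cube 2) ∧
          c = KZ.of r} ∪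
       {c | ∃ (r : IntegralRep 1) (a m : ℕ), r.domain = cube 1 ∧
          EqOn r.integrand (fun p => p 0 ^ a / ((N : ℝ) - p 0) ^ m) (cube 1) ∧ c = KZ.of r} ∪
       {c | ∃ (r : IntegralRep 0) (q : ℚ), r.domain = cube 0 ∧
          EqOn r.integrand (fun _ => (q : ℝ)) (cube 0) ∧ c = KZ.of r}),
      KZ.eval c = 0 → c ∈ KZ.relations := by
  -- the three carrier families
  set f2 : ℚ → (Fin 2 → ℝ) → ℝ := fun α p => (α : ℝ) / ((N : ℝ) - p 0 * p 1) with hf2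
  set f1 : ℚ → (Fin 1 → ℝ) → ℝ := fun β p => (β : ℝ) / ((N : ℝ) - p 0) with hf1
  set f0 : ℚ → (Fin 0 → ℝ) → ℝ := fun γ _ => (γ : ℝ) with hf0
  obtain ⟨hA2, hA1, hA0⟩ := nf_families_additive N
  -- `NF x` : `x` is congruent to a rational normal form
  let NF : FormalRep → Prop := fun x => ∃ (α β γ : ℚ) (s₂ : IntegralRep 2) (s₁ : IntegralRep 1)
      (s₀ : IntegralRep 0),
    s₂.domain = cube 2 ∧ EqOn s₂.integrand (f2 α) (cube 2) ∧
    s₁.domain = cube 1 ∧ EqOn s₁.integrand (f1 β) (cube 1) ∧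
    s₀.domain = cube 0 ∧ EqOn s₀.integrand (f0 γ) (cube 0) ∧
    x - (KZ.of s₂ + KZ.of s₁ + KZ.of s₀) ∈ KZ.relations
  -- zero
  have hNF0 : NF 0 := by
    obtain ⟨s₂, hs₂, hs₂i⟩ := exists_nf2 hN 0
    obtain ⟨s₁, hs₁, hs₁i⟩ := exists_nf1 hN 0
    obtain ⟨s₀, hs₀, hs₀i⟩ := exists_nf0 0
    refine ⟨0, 0, 0, s₂, s₁, s₀, hs₂, hs₂i, hs₁, hs₁i, hs₀, hs₀i, ?_⟩
    rw [zero_sub, neg_mem_iff]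
    exact KZ.relations.add_mem (KZ.relations.add_mem
      (carrier_zero (D := cube 2) f2 (fun x => by simp [hf2]) hs₂ hs₂i)
      (carrier_zero (D := cube 1) f1 (fun x => by simp [hf1]) hs₁ hs₁i))
      (carrier_zero (D := cube 0) f0 (fun x => by simp [hf0]) hs₀ hs₀i)
  -- addition
  have hNFadd : ∀ x y, NF x → NF y → NF (x + y) := by
    rintro x y ⟨α, β, γ, s₂, s₁, s₀, hs₂, hs₂i, hs₁, hs₁i, hs₀, hs₀i, hx⟩
      ⟨α', β', γ', t₂, t₁, t₀, ht₂, ht₂i, ht₁, ht₁i, ht₀, ht₀i, hy⟩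
    obtain ⟨u₂, hu₂, hu₂i⟩ := exists_nf2 hN (α + α')
    obtain ⟨u₁, hu₁, hu₁i⟩ := exists_nf1 hN (β + β')
    obtain ⟨u₀, hu₀, hu₀i⟩ := exists_nf0 (γ + γ')
    have e₂ := carrier_add (D := cube 2) f2 hA2 hs₂ hs₂i ht₂ ht₂i hu₂ hu₂i
    have e₁ := carrier_add (D := cube 1) f1 hA1 hs₁ hs₁i ht₁ ht₁i hu₁ hu₁i
    have e₀ := carrier_add (D := cube 0) f0 hA0 hs₀ hs₀i ht₀ ht₀i hu₀ hu₀i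
    refine ⟨α + α', β + β', γ + γ', u₂, u₁, u₀, hu₂, hu₂i, hu₁, hu₁i, hu₀, hu₀i, ?_⟩
    have : x + y - (KZ.of u₂ + KZ.of u₁ + KZ.of u₀) =
        (x - (KZ.of s₂ + KZ.of s₁ + KZ.of s₀)) + (y - (KZ.of t₂ + KZ.of t₁ + KZ.of t₀))
          - (KZ.of u₂ - KZ.of s₂ - KZ.of t₂) - (KZ.of u₁ - KZ.of s₁ - KZ.of t₁)
          - (KZ.of u₀ - KZ.of s₀ - KZ.of t₀) := by abel
    rw [this]
    exact KZ.relations.sub_mem (KZ.relations.sub_mem (KZ.relations.sub_mem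
      (KZ.relations.add_mem hx hy) e₂) e₁) e₀
  -- negation
  have hNFneg : ∀ x, NF x → NF (-x) := by
    rintro x ⟨α, β, γ, s₂, s₁, s₀, hs₂, hs₂i, hs₁, hs₁i, hs₀, hs₀i, hx⟩
    obtain ⟨t₂, ht₂, ht₂i⟩ := exists_nf2 hN (-α)
    obtain ⟨t₁, ht₁, ht₁i⟩ := exists_nf1 hN (-β)
    obtain ⟨t₀, ht₀, ht₀i⟩ := exists_nf0 (-γ)
    obtain ⟨u₂, hu₂, hu₂i⟩ := exists_nf2 hN (α + -α)
    obtain ⟨u₁, hu₁, hu₁i⟩ := exists_nf1 hN (β + -β)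
    obtain ⟨u₀, hu₀, hu₀i⟩ := exists_nf0 (γ + -γ)
    have e₂ := carrier_add (D := cube 2) f2 hA2 hs₂ hs₂i ht₂ ht₂i hu₂ hu₂i
    have e₁ := carrier_add (D := cube 1) f1 hA1 hs₁ hs₁i ht₁ ht₁i hu₁ hu₁i
    have e₀ := carrier_add (D := cube 0) f0 hA0 hs₀ hs₀i ht₀ ht₀i hu₀ hu₀i
    have z₂ : KZ.of u₂ ∈ KZ.relations :=
      carrier_zero (D := cube 2) f2 (fun x => by simp [hf2]) hu₂ (by rw [add_neg_cancel] at hu₂i; exact hu₂i)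
    have z₁ : KZ.of u₁ ∈ KZ.relations :=
      carrier_zero (D := cube 1) f1 (fun x => by simp [hf1]) hu₁ (by rw [add_neg_cancel] at hu₁i; exact hu₁i)
    have z₀ : KZ.of u₀ ∈ KZ.relations :=
      carrier_zero (D := cube 0) f0 (fun x => by simp [hf0]) hu₀ (by rw [add_neg_cancel] at hu₀i; exact hu₀i)
    refine ⟨-α, -β, -γ, t₂, t₁, t₀, ht₂, ht₂i, ht₁, ht₁i, ht₀, ht₀i, ?_⟩
    have : -x - (KZ.of t₂ + KZ.of t₁ + KZ.of t₀) =
        -(x - (KZ.of s₂ + KZ.of s₁ + KZ.of s₀))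
          + (KZ.of u₂ - KZ.of s₂ - KZ.of t₂) + (KZ.of u₁ - KZ.of s₁ - KZ.of t₁)
          + (KZ.of u₀ - KZ.of s₀ - KZ.of t₀) - KZ.of u₂ - KZ.of u₁ - KZ.of u₀ := by abel
    rw [this]
    exact KZ.relations.sub_mem (KZ.relations.sub_mem (KZ.relations.sub_mem
      (KZ.relations.add_mem (KZ.relations.add_mem (KZ.relations.add_mem
        (KZ.relations.neg_mem hx) e₂) e₁) e₀) z₂) z₁) z₀
  -- generators
  have hNFgen : ∀ x ∈ ({c | ∃ (r : IntegralRep 2) (a b m : ℕ), r.domain = cube 2 ∧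
          EqOn r.integrand (fun p => p 0 ^ a * p 1 ^ b / ((N : ℝ) - p 0 * p 1) ^ m) (cube 2) ∧
          c = KZ.of r} ∪
       {c | ∃ (r : IntegralRep 1) (a m : ℕ), r.domain = cube 1 ∧
          EqOn r.integrand (fun p => p 0 ^ a / ((N : ℝ) - p 0) ^ m) (cube 1) ∧ c = KZ.of r} ∪
       {c | ∃ (r : IntegralRep 0) (q : ℚ), r.domain = cube 0 ∧
          EqOn r.integrand (fun _ => (q : ℝ)) (cube 0) ∧ c = KZ.of r}), NF x := by
    rintro x ((⟨r, a, b, m, hr, hri, rfl⟩ | ⟨r, a, m, hr, hri, rfl⟩) | ⟨r, q, hr, hri, rfl⟩)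
    · -- a box generator: `stub_boxTwoReduction` with `q = 1`
      obtain ⟨α, β, γ, s₂, s₁, s₀, hs₂, hs₂i, hs₁, hs₁i, hs₀, hs₀i, h⟩ :=
        stub_boxTwoReduction N hN 1 a b m r hr fun p hp => by rw [hri hp]; push_cast; ring
      exact ⟨α, β, γ, s₂, s₁, s₀, hs₂, hs₂i, hs₁, hs₁i, hs₀, hs₀i, h⟩
    · -- a line generator: `lineReduction` with `q = 1`, plus the zero box normal form
      obtain ⟨β, γ, s₁, s₀, hs₁, hs₁i, hs₀, hs₀i, h⟩ :=
        lineReduction hN a 1 m r hr fun p hp => by rw [hri hp]; push_cast; ring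
      obtain ⟨s₂, hs₂, hs₂i⟩ := exists_nf2 hN 0
      have z₂ : KZ.of s₂ ∈ KZ.relations := carrier_zero (D := cube 2) f2 (fun x => by simp [hf2]) hs₂ hs₂i
      refine ⟨0, β, γ, s₂, s₁, s₀, hs₂, hs₂i, hs₁, hs₁i, hs₀, hs₀i, ?_⟩
      have : KZ.of r - (KZ.of s₂ + KZ.of s₁ + KZ.of s₀) = (KZ.of r - (KZ.of s₁ + KZ.of s₀)) - KZ.of s₂ := by
        abel
      rw [this]
      exact KZ.relations.sub_mem h z₂
    · -- a rational constant is its own normal form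
      obtain ⟨s₂, hs₂, hs₂i⟩ := exists_nf2 hN 0
      obtain ⟨s₁, hs₁, hs₁i⟩ := exists_nf1 hN 0
      have z₂ : KZ.of s₂ ∈ KZ.relations := carrier_zero (D := cube 2) f2 (fun x => by simp [hf2]) hs₂ hs₂i
      have z₁ : KZ.of s₁ ∈ KZ.relations := carrier_zero (D := cube 1) f1 (fun x => by simp [hf1]) hs₁ hs₁i
      refine ⟨0, 0, q, s₂, s₁, r, hs₂, hs₂i, hs₁, hs₁i, hr, hri, ?_⟩
      have : KZ.of r - (KZ.of s₂ + KZ.of s₁ + KZ.of r) = -KZ.of s₂ - KZ.of s₁ := by abel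
      rw [this]
      exact KZ.relations.sub_mem (KZ.relations.neg_mem z₂) z₁
  -- closure induction
  intro c hc h0
  have hNFc : NF c := by
    clear h0
    induction hc using AddSubgroup.closure_induction with
    | mem x hx => exact hNFgen x hx
    | zero => exact hNF0
    | add x y _ _ hx hy => exact hNFadd x y hx hy
    | neg x _ hx => exact hNFneg x hx
  obtain ⟨α, β, γ, s₂, s₁, s₀, hs₂, hs₂i, hs₁, hs₁i, hs₀, hs₀i, hcn⟩ := hNFc
  -- the value of the normal form vanishes
  have hval : KZ.eval (KZ.of s₂ + KZ.of s₁ + KZ.of s₀) = 0 := by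
    have : KZ.eval _ = 0 := (AddMonoidHom.mem_ker).1 (relations_le_ker_eval_holds hcn)
    rwa [map_sub, h0, zero_sub, neg_eq_zero] at this
  rw [map_add, map_add, eval_nf2 hs₂ hs₂i, eval_nf1 hs₁ hs₁i, eval_nf0 hs₀ hs₀i] at hval
  obtain ⟨rfl, rfl, rfl⟩ : γ = 0 ∧ β = 0 ∧ α = 0 := hrig γ β α (by linear_combination hval)
  -- so the normal form has zero integrands and is a relation
  have z₂ : KZ.of s₂ ∈ KZ.relations := carrier_zero (D := cube 2) f2 (fun x => by simp [hf2]) hs₂ hs₂i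
  have z₁ : KZ.of s₁ ∈ KZ.relations := carrier_zero (D := cube 1) f1 (fun x => by simp [hf1]) hs₁ hs₁i
  have z₀ : KZ.of s₀ ∈ KZ.relations := carrier_zero (D := cube 0) f0 (fun x => by simp [hf0]) hs₀ hs₀i
  have : c = (c - (KZ.of s₂ + KZ.of s₁ + KZ.of s₀)) + KZ.of s₂ + KZ.of s₁ + KZ.of s₀ := by abel
  rw [this]
  exact KZ.relations.add_mem (KZ.relations.add_mem (KZ.relations.add_mem hcn z₂) z₁) z₀

/-- **The weight-one island, UNCONDITIONAL** `padeBoxKernelOne N` (glue over the landed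
`lineReduction` and `stub_lineRigidity`): for every `N ≥ 2`, Conjecture 1 in kernel form on the LINE sector generated by
`[□¹, x^c/(N−x)^m]` (`c, m ∈ ℕ`) and the rational constants `[pt, q]` — every `ℤ`-combination of
value `0` lies in `KZ.relations`. The rigidity of its two normal-form values `1, L₁ = ∫_□ dx/(N−x)
= log(N/(N−1))` over `ℚ` is Baker's theorem in the tree (`baker_holds`, one logarithm of the rational
number `N/(N−1) ≠ 1`), supplied by `stub_lineRigidity`; the reduction is `lineReduction`.
[cite: KontsevichZagier2001, §1.2] [cite: Baker1975, Thm 2.1] -/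
theorem padeBoxKernelOne (N : ℕ) (hN : 2 ≤ N) :
    ∀ c ∈ AddSubgroup.closure
      ({c | ∃ (r : IntegralRep 1) (a m : ℕ), r.domain = cube 1 ∧
          EqOn r.integrand (fun p => p 0 ^ a / ((N : ℝ) - p 0) ^ m) (cube 1) ∧ c = KZ.of r} ∪
       {c | ∃ (r : IntegralRep 0) (q : ℚ), r.domain = cube 0 ∧
          EqOn r.integrand (fun _ => (q : ℝ)) (cube 0) ∧ c = KZ.of r}),
      KZ.eval c = 0 → c ∈ KZ.relations := by
  -- the two carrier families
  set f1 : ℚ → (Fin 1 → ℝ) → ℝ := fun β p => (β : ℝ) / ((N : ℝ) - p 0) with hf1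
  set f0 : ℚ → (Fin 0 → ℝ) → ℝ := fun γ _ => (γ : ℝ) with hf0
  obtain ⟨-, hA1, hA0⟩ := nf_families_additive N
  -- `NF x` : `x` is congruent to a rational line normal form
  let NF : FormalRep → Prop := fun x => ∃ (β γ : ℚ) (s₁ : IntegralRep 1) (s₀ : IntegralRep 0),
    s₁.domain = cube 1 ∧ EqOn s₁.integrand (f1 β) (cube 1) ∧
    s₀.domain = cube 0 ∧ EqOn s₀.integrand (f0 γ) (cube 0) ∧
    x - (KZ.of s₁ + KZ.of s₀) ∈ KZ.relations
  have hNF0 : NF 0 := by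
    obtain ⟨s₁, hs₁, hs₁i⟩ := exists_nf1 hN 0
    obtain ⟨s₀, hs₀, hs₀i⟩ := exists_nf0 0
    refine ⟨0, 0, s₁, s₀, hs₁, hs₁i, hs₀, hs₀i, ?_⟩
    rw [zero_sub, neg_mem_iff]
    exact KZ.relations.add_mem
      (carrier_zero (D := cube 1) f1 (fun x => by simp [hf1]) hs₁ hs₁i)
      (carrier_zero (D := cube 0) f0 (fun x => by simp [hf0]) hs₀ hs₀i)
  have hNFadd : ∀ x y, NF x → NF y → NF (x + y) := by
    rintro x y ⟨β, γ, s₁, s₀, hs₁, hs₁i, hs₀, hs₀i, hx⟩ ⟨β', γ', t₁, t₀, ht₁, ht₁i, ht₀, ht₀i, hy⟩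
    obtain ⟨u₁, hu₁, hu₁i⟩ := exists_nf1 hN (β + β')
    obtain ⟨u₀, hu₀, hu₀i⟩ := exists_nf0 (γ + γ')
    have e₁ := carrier_add (D := cube 1) f1 hA1 hs₁ hs₁i ht₁ ht₁i hu₁ hu₁i
    have e₀ := carrier_add (D := cube 0) f0 hA0 hs₀ hs₀i ht₀ ht₀i hu₀ hu₀i
    refine ⟨β + β', γ + γ', u₁, u₀, hu₁, hu₁i, hu₀, hu₀i, ?_⟩
    have : x + y - (KZ.of u₁ + KZ.of u₀) =
        (x - (KZ.of s₁ + KZ.of s₀)) + (y - (KZ.of t₁ + KZ.of t₀))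
          - (KZ.of u₁ - KZ.of s₁ - KZ.of t₁) - (KZ.of u₀ - KZ.of s₀ - KZ.of t₀) := by abel
    rw [this]
    exact KZ.relations.sub_mem (KZ.relations.sub_mem (KZ.relations.add_mem hx hy) e₁) e₀
  have hNFneg : ∀ x, NF x → NF (-x) := by
    rintro x ⟨β, γ, s₁, s₀, hs₁, hs₁i, hs₀, hs₀i, hx⟩
    obtain ⟨t₁, ht₁, ht₁i⟩ := exists_nf1 hN (-β)
    obtain ⟨t₀, ht₀, ht₀i⟩ := exists_nf0 (-γ)
    obtain ⟨u₁, hu₁, hu₁i⟩ := exists_nf1 hN (β + -β)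
    obtain ⟨u₀, hu₀, hu₀i⟩ := exists_nf0 (γ + -γ)
    have e₁ := carrier_add (D := cube 1) f1 hA1 hs₁ hs₁i ht₁ ht₁i hu₁ hu₁i
    have e₀ := carrier_add (D := cube 0) f0 hA0 hs₀ hs₀i ht₀ ht₀i hu₀ hu₀i
    have z₁ : KZ.of u₁ ∈ KZ.relations :=
      carrier_zero (D := cube 1) f1 (fun x => by simp [hf1]) hu₁ (by rw [add_neg_cancel] at hu₁i; exact hu₁i)
    have z₀ : KZ.of u₀ ∈ KZ.relations :=
      carrier_zero (D := cube 0) f0 (fun x => by simp [hf0]) hu₀ (by rw [add_neg_cancel] at hu₀i; exact hu₀i)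
    refine ⟨-β, -γ, t₁, t₀, ht₁, ht₁i, ht₀, ht₀i, ?_⟩
    have : -x - (KZ.of t₁ + KZ.of t₀) =
        -(x - (KZ.of s₁ + KZ.of s₀)) + (KZ.of u₁ - KZ.of s₁ - KZ.of t₁)
          + (KZ.of u₀ - KZ.of s₀ - KZ.of t₀) - KZ.of u₁ - KZ.of u₀ := by abel
    rw [this]
    exact KZ.relations.sub_mem (KZ.relations.sub_mem (KZ.relations.add_mem (KZ.relations.add_mem
      (KZ.relations.neg_mem hx) e₁) e₀) z₁) z₀
  have hNFgen : ∀ x ∈ ({c | ∃ (r : IntegralRep 1) (a m : ℕ), r.domain = cube 1 ∧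
          EqOn r.integrand (fun p => p 0 ^ a / ((N : ℝ) - p 0) ^ m) (cube 1) ∧ c = KZ.of r} ∪
       {c | ∃ (r : IntegralRep 0) (q : ℚ), r.domain = cube 0 ∧
          EqOn r.integrand (fun _ => (q : ℝ)) (cube 0) ∧ c = KZ.of r}), NF x := by
    rintro x (⟨r, a, m, hr, hri, rfl⟩ | ⟨r, q, hr, hri, rfl⟩)
    · obtain ⟨β, γ, s₁, s₀, hs₁, hs₁i, hs₀, hs₀i, h⟩ :=
        lineReduction hN a 1 m r hr fun p hp => by rw [hri hp]; push_cast; ring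
      exact ⟨β, γ, s₁, s₀, hs₁, hs₁i, hs₀, hs₀i, h⟩
    · obtain ⟨s₁, hs₁, hs₁i⟩ := exists_nf1 hN 0
      have z₁ : KZ.of s₁ ∈ KZ.relations := carrier_zero (D := cube 1) f1 (fun x => by simp [hf1]) hs₁ hs₁i
      refine ⟨0, q, s₁, r, hs₁, hs₁i, hr, hri, ?_⟩
      have : KZ.of r - (KZ.of s₁ + KZ.of r) = -KZ.of s₁ := by abel
      rw [this]
      exact KZ.relations.neg_mem z₁
  intro c hc h0
  have hNFc : NF c := by
    clear h0
    induction hc using AddSubgroup.closure_induction with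
    | mem x hx => exact hNFgen x hx
    | zero => exact hNF0
    | add x y _ _ hx hy => exact hNFadd x y hx hy
    | neg x _ hx => exact hNFneg x hx
  obtain ⟨β, γ, s₁, s₀, hs₁, hs₁i, hs₀, hs₀i, hcn⟩ := hNFc
  have hval : KZ.eval (KZ.of s₁ + KZ.of s₀) = 0 := by
    have : KZ.eval _ = 0 := (AddMonoidHom.mem_ker).1 (relations_le_ker_eval_holds hcn)
    rwa [map_sub, h0, zero_sub, neg_eq_zero] at this
  rw [map_add, eval_nf1 hs₁ hs₁i, eval_nf0 hs₀ hs₀i] at hval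
  obtain ⟨rfl, rfl⟩ : γ = 0 ∧ β = 0 := stub_lineRigidity N hN γ β (by linear_combination hval)
  have z₁ : KZ.of s₁ ∈ KZ.relations := carrier_zero (D := cube 1) f1 (fun x => by simp [hf1]) hs₁ hs₁i
  have z₀ : KZ.of s₀ ∈ KZ.relations := carrier_zero (D := cube 0) f0 (fun x => by simp [hf0]) hs₀ hs₀i
  have : c = (c - (KZ.of s₁ + KZ.of s₀)) + KZ.of s₁ + KZ.of s₀ := by abel
  rw [this]
  exact KZ.relations.add_mem (KZ.relations.add_mem hcn z₁) z₀

/-! ## The route item -/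

/-- **`PadeBoxIslands`** (item stmt-KontsevichZagierPeriods-15909 of route HermiteRigidity, PROVED): for
every integer `N ≥ 2`, (i) the kernel form of Conjecture 1 on the line island (unconditional,
`padeBoxKernelOne`) and (ii) the kernel form on the `(2, 1/N)` box island modulo the `ℚ`-rigidity of
`1, Li₁(1/N), Li₂(1/N)` (`padeBoxKernelTwo`) — the route declaration itself (its closed cube
`{x | ∀ i, 0 ≤ x i ∧ x i ≤ 1}` is definitionally `KZ.cube n`).
[cite: KontsevichZagier2001, §1.2] [cite: ViolaZudilin2018, Thm 1] [cite: Baker1975, Thm 2.1] -/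
theorem padeBoxIslands_proof :
    Summit.KontsevichZagierPeriods.KontsevichZagierPeriods.Theses.HermiteRigidity.PadeBoxIslands := by
  unfold Summit.KontsevichZagierPeriods.KontsevichZagierPeriods.Theses.HermiteRigidity.PadeBoxIslands
  exact ⟨fun N hN => padeBoxKernelOne N hN, fun N hN hrig => padeBoxKernelTwo N hN hrig⟩

end Summit.KontsevichZagierPeriods.HermiteRigidity.PadeBoxIslands

end
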